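import Mathlib
import Summits.Ventures.PercRepro2.Defs
import Summits.Ventures.PercRepro2.Independence
import Summits.Ventures.PercRepro2.Harris
import Summits.Ventures.PercRepro2.Graph
import Summits.Ventures.PercRepro2.Exploration
import Summits.Ventures.PercRepro2.Events
import Summits.Ventures.PercRepro2.Induced
import Summits.Ventures.PercRepro2.SeedSet
import Summits.Ventures.PercRepro2.MultiSourceFun
import Summits.Ventures.PercRepro2.CrossRootT
import Summits.Ventures.PercRepro2.RBDefs
import Summits.Ventures.PercRepro2.RBChain
import Summits.Ventures.PercRepro2.RBTransport

/-!
# The 0-step atoms and the assembly: `RBcrossOn (revealState W) (C(w′)) ⟸ RB_all`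
(blind cell PercRepro2, typer-1; mine-a g3/g4 proofs/MINEA-RBBHK.md §8 "THE THREE KINDS OF ATOMS";
lead g12 ASSIGNMENTS v11.14 typer (4))

On an atom `x` of the revealment of `W` where a revealed cluster `A_w` contains the root `s`, the
root `t`, a marker or the new vertex `w′`, one of `X`, `Y`, `C(w′)` is CONSTANT on `Q ∩ {state = x}`
and the atom inequality is an EQUALITY (`atomIneq_of_subset_X`, `atomIneq_of_disjoint_X`,
`atomIneq_of_subset_Y`, `atomIneq_of_disjoint_Y`, `atomIneq_of_const_τ`: the partition over `y`
and `x/0 = 0`). The remaining atoms are holes and `RBTransport.atom_step_of_RBcross` applies with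
row 2′RB at the pinned weights. Hence

* **`RBcrossOn_of_RBcross_all`**: if `RBcross q ends o b s t w′` holds for every admissible `q` on
  the graph, then `RBcrossOn p ends s t (revealState W) (C(w′)) X Y` for every `W`;
* **`covRevealed_insert_le_of_RB_all`**: with `RB_all` (over all graphs), the chain
  `Cov_{𝓖_{W ∪ {w′}}} ≤ Cov_{𝓖_W}` (cleared by `P(Q)`) holds for every `W` and `w′ ∉ W` — mine-a's
  `cov_revealed_antitone` as a corollary of row 2′RB, unconditionally.
-/

namespace Summit.Ventures.PercRepro2

namespace RB

open scoped Classical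

variable {V : Type*} {E : Type*} [Fintype E] [DecidableEq E] [Fintype V] [DecidableEq V]
  {R : Type*} [Field R] [LinearOrder R] [IsStrictOrderedRing R]

/-! ## The atom inequality and its trivial cases -/

section AtomIneq

variable (p : E → R) (ends : E → Sym2 V) (s t : V)

/-- The per-atom (RB-cross) inequality of `RBcrossOn σ τ X Y` at the atom `x`. -/
def atomIneq {α β : Type*} [Fintype β] (σ : Config E → α) (τ : Config E → β)
    (X Y : Set (Config E)) (x : α) : Prop :=
  (∑ y : β, prob p (Qst ends s t ∩ {ω | σ ω = x} ∩ {ω | τ ω = y} ∩ X) *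
      prob p (Qst ends s t ∩ {ω | σ ω = x} ∩ {ω | τ ω = y} ∩ Y) /
    prob p (Qst ends s t ∩ {ω | σ ω = x} ∩ {ω | τ ω = y})) ≤
  prob p (Qst ends s t ∩ {ω | σ ω = x} ∩ X) * prob p (Qst ends s t ∩ {ω | σ ω = x} ∩ Y) /
    prob p (Qst ends s t ∩ {ω | σ ω = x})

omit [DecidableEq V] [LinearOrder R] [IsStrictOrderedRing R] in
/-- Partition by the value of a state map: `Σ_y P(A ∩ {τ = y}) = P(A)`. -/
lemma sum_prob_inter_state {β : Type*} [Fintype β] (τ : Config E → β) (A : Set (Config E)) :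
    ∑ y : β, prob p (A ∩ {ω | τ ω = y}) = prob p A := by
  unfold prob
  rw [Finset.sum_comm]
  refine Finset.sum_congr rfl fun ω _ => ?_
  rw [Finset.sum_eq_single (τ ω)]
  · by_cases hA : ω ∈ A
    · rw [Set.indicator_of_mem hA,
        Set.indicator_of_mem (show ω ∈ A ∩ {ω' | τ ω' = τ ω} from ⟨hA, rfl⟩)]
    · rw [Set.indicator_of_notMem hA, Set.indicator_of_notMem (fun h => hA h.1)]
  · intro y _ hy
    apply Set.indicator_of_notMem
    rintro ⟨_, hy'⟩
    exact hy hy'.symm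
  · intro h; exact absurd (Finset.mem_univ _) h

omit [DecidableEq V] [IsStrictOrderedRing R] in
/-- `a · b / a = b` when `b ≤ a` in probability (both vanish when `a = 0`). -/
lemma mul_div_self_of_le {a c : R} (hca : c ≤ a) (hc : 0 ≤ c) : a * c / a = c := by
  by_cases ha : a = 0
  · subst ha
    have : c = 0 := le_antisymm hca hc
    simp [this]
  · field_simp

omit [DecidableEq V] [Fintype V] in
/-- **0-step, `X` sure on the atom**: if `Q ∩ {σ = x} ⊆ X`, the atom inequality is an equality. -/
lemma atomIneq_of_subset_X (hp : IsProbVec p) {α β : Type*} [Fintype β] (σ : Config E → α)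
    (τ : Config E → β) (X Y : Set (Config E)) (x : α) (hX : Qst ends s t ∩ {ω | σ ω = x} ⊆ X) :
    atomIneq p ends s t σ τ X Y x := by
  unfold atomIneq
  have hterm : ∀ y : β,
      prob p (Qst ends s t ∩ {ω | σ ω = x} ∩ {ω | τ ω = y} ∩ X) *
          prob p (Qst ends s t ∩ {ω | σ ω = x} ∩ {ω | τ ω = y} ∩ Y) /
        prob p (Qst ends s t ∩ {ω | σ ω = x} ∩ {ω | τ ω = y}) =
      prob p (Qst ends s t ∩ {ω | σ ω = x} ∩ Y ∩ {ω | τ ω = y}) := by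
    intro y
    have e1 : Qst ends s t ∩ {ω | σ ω = x} ∩ {ω | τ ω = y} ∩ X =
        Qst ends s t ∩ {ω | σ ω = x} ∩ {ω | τ ω = y} := by
      ext ω
      simp only [Set.mem_inter_iff]
      exact ⟨fun h => h.1, fun h => ⟨h, hX ⟨h.1.1, h.1.2⟩⟩⟩
    have e2 : Qst ends s t ∩ {ω | σ ω = x} ∩ {ω | τ ω = y} ∩ Y =
        Qst ends s t ∩ {ω | σ ω = x} ∩ Y ∩ {ω | τ ω = y} := by
      ext ω; simp only [Set.mem_inter_iff]; tauto
    rw [e1, e2]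
    exact mul_div_self_of_le (prob_mono hp (by
      rintro ω ⟨⟨hq, _⟩, hy⟩; exact ⟨hq, hy⟩)) (prob_nonneg hp _)
  simp_rw [hterm]
  rw [sum_prob_inter_state]
  have e3 : Qst ends s t ∩ {ω | σ ω = x} ∩ X = Qst ends s t ∩ {ω | σ ω = x} := by
    ext ω
    simp only [Set.mem_inter_iff]
    exact ⟨fun h => h.1, fun h => ⟨h, hX h⟩⟩
  rw [e3]
  exact le_of_eq (mul_div_self_of_le (prob_mono hp Set.inter_subset_left) (prob_nonneg hp _)).symm

omit [DecidableEq V] [Fintype V] [IsStrictOrderedRing R] in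
/-- **0-step, `X` impossible on the atom**: if `Q ∩ {σ = x} ∩ X = ∅`, both sides vanish. -/
lemma atomIneq_of_disjoint_X {α β : Type*} [Fintype β] (σ : Config E → α)
    (τ : Config E → β) (X Y : Set (Config E)) (x : α)
    (hX : Qst ends s t ∩ {ω | σ ω = x} ∩ X = ∅) :
    atomIneq p ends s t σ τ X Y x := by
  unfold atomIneq
  have hterm : ∀ y : β,
      prob p (Qst ends s t ∩ {ω | σ ω = x} ∩ {ω | τ ω = y} ∩ X) *
          prob p (Qst ends s t ∩ {ω | σ ω = x} ∩ {ω | τ ω = y} ∩ Y) /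
        prob p (Qst ends s t ∩ {ω | σ ω = x} ∩ {ω | τ ω = y}) = 0 := by
    intro y
    have e : Qst ends s t ∩ {ω | σ ω = x} ∩ {ω | τ ω = y} ∩ X = ∅ := by
      rw [Set.eq_empty_iff_forall_notMem] at hX ⊢
      rintro ω ⟨⟨⟨hq, hx⟩, _⟩, hX'⟩
      exact hX ω ⟨⟨hq, hx⟩, hX'⟩
    rw [e, prob_empty, zero_mul, zero_div]
  simp_rw [hterm]
  rw [Finset.sum_const_zero, hX, prob_empty, zero_mul, zero_div]

omit [DecidableEq V] [Fintype V] in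
/-- **0-step, `Y` sure on the atom**. -/
lemma atomIneq_of_subset_Y (hp : IsProbVec p) {α β : Type*} [Fintype β] (σ : Config E → α)
    (τ : Config E → β) (X Y : Set (Config E)) (x : α) (hY : Qst ends s t ∩ {ω | σ ω = x} ⊆ Y) :
    atomIneq p ends s t σ τ X Y x := by
  unfold atomIneq
  have hterm : ∀ y : β,
      prob p (Qst ends s t ∩ {ω | σ ω = x} ∩ {ω | τ ω = y} ∩ X) *
          prob p (Qst ends s t ∩ {ω | σ ω = x} ∩ {ω | τ ω = y} ∩ Y) /
        prob p (Qst ends s t ∩ {ω | σ ω = x} ∩ {ω | τ ω = y}) =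
      prob p (Qst ends s t ∩ {ω | σ ω = x} ∩ X ∩ {ω | τ ω = y}) := by
    intro y
    have e1 : Qst ends s t ∩ {ω | σ ω = x} ∩ {ω | τ ω = y} ∩ Y =
        Qst ends s t ∩ {ω | σ ω = x} ∩ {ω | τ ω = y} := by
      ext ω
      simp only [Set.mem_inter_iff]
      exact ⟨fun h => h.1, fun h => ⟨h, hY ⟨h.1.1, h.1.2⟩⟩⟩
    have e2 : Qst ends s t ∩ {ω | σ ω = x} ∩ {ω | τ ω = y} ∩ X =
        Qst ends s t ∩ {ω | σ ω = x} ∩ X ∩ {ω | τ ω = y} := by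
      ext ω; simp only [Set.mem_inter_iff]; tauto
    rw [e1, e2, mul_comm]
    exact mul_div_self_of_le (prob_mono hp (by
      rintro ω ⟨⟨hq, _⟩, hy⟩; exact ⟨hq, hy⟩)) (prob_nonneg hp _)
  simp_rw [hterm]
  rw [sum_prob_inter_state]
  have e3 : Qst ends s t ∩ {ω | σ ω = x} ∩ Y = Qst ends s t ∩ {ω | σ ω = x} := by
    ext ω
    simp only [Set.mem_inter_iff]
    exact ⟨fun h => h.1, fun h => ⟨h, hY h⟩⟩
  rw [e3, mul_comm]
  exact le_of_eq (mul_div_self_of_le (prob_mono hp Set.inter_subset_left) (prob_nonneg hp _)).symm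

omit [DecidableEq V] [Fintype V] [IsStrictOrderedRing R] in
/-- **0-step, `Y` impossible on the atom**. -/
lemma atomIneq_of_disjoint_Y {α β : Type*} [Fintype β] (σ : Config E → α)
    (τ : Config E → β) (X Y : Set (Config E)) (x : α)
    (hY : Qst ends s t ∩ {ω | σ ω = x} ∩ Y = ∅) :
    atomIneq p ends s t σ τ X Y x := by
  unfold atomIneq
  have hterm : ∀ y : β,
      prob p (Qst ends s t ∩ {ω | σ ω = x} ∩ {ω | τ ω = y} ∩ X) *
          prob p (Qst ends s t ∩ {ω | σ ω = x} ∩ {ω | τ ω = y} ∩ Y) /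
        prob p (Qst ends s t ∩ {ω | σ ω = x} ∩ {ω | τ ω = y}) = 0 := by
    intro y
    have e : Qst ends s t ∩ {ω | σ ω = x} ∩ {ω | τ ω = y} ∩ Y = ∅ := by
      rw [Set.eq_empty_iff_forall_notMem] at hY ⊢
      rintro ω ⟨⟨⟨hq, hx⟩, _⟩, hY'⟩
      exact hY ω ⟨⟨hq, hx⟩, hY'⟩
    rw [e, prob_empty, mul_zero, zero_div]
  simp_rw [hterm]
  rw [Finset.sum_const_zero, hY, prob_empty, mul_zero, zero_div]

omit [DecidableEq V] [Fintype V] [IsStrictOrderedRing R] in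
/-- **0-step, `τ` constant on the atom**: if `Q ∩ {σ = x} ⊆ {τ = y₀}`, the `y`-sum has one term and
the atom inequality is an equality. -/
lemma atomIneq_of_const_τ {α β : Type*} [Fintype β] (σ : Config E → α)
    (τ : Config E → β) (X Y : Set (Config E)) (x : α) (y₀ : β)
    (hτ : Qst ends s t ∩ {ω | σ ω = x} ⊆ {ω | τ ω = y₀}) :
    atomIneq p ends s t σ τ X Y x := by
  unfold atomIneq
  rw [Finset.sum_eq_single y₀]
  · have e : Qst ends s t ∩ {ω | σ ω = x} ∩ {ω | τ ω = y₀} = Qst ends s t ∩ {ω | σ ω = x} := by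
      ext ω
      simp only [Set.mem_inter_iff]
      exact ⟨fun h => h.1, fun h => ⟨h, hτ h⟩⟩
    rw [e]
  · intro y _ hy
    have e : Qst ends s t ∩ {ω | σ ω = x} ∩ {ω | τ ω = y} = ∅ := by
      rw [Set.eq_empty_iff_forall_notMem]
      rintro ω ⟨hq, hy'⟩
      exact hy (hy'.symm.trans (hτ hq))
    have e1 : Qst ends s t ∩ {ω | σ ω = x} ∩ {ω | τ ω = y} ∩ X = ∅ := by
      rw [e, Set.empty_inter]
    rw [e1, prob_empty, zero_mul, zero_div]
  · intro h; exact absurd (Finset.mem_univ _) h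

end AtomIneq

/-! ## The assembly -/

section Assembly

variable (p : E → R) (ends : E → Sym2 V) (W : Finset V) (o b s t w' : V)

omit [Fintype E] [DecidableEq E] [Fintype V] [DecidableEq V] in
/-- On the atom, a vertex of a revealed cluster has that cluster: `u ∈ A_w ⇒ C(u) = A_w`. -/
lemma cluster_eq_of_mem_atom {x : ↥W → Set V} {ω : Config E} (hω : ω ∈ atom ends W x) {w : ↥W}
    {u : V} (hu : u ∈ x w) : cluster ends ω u = x w := by
  have hw := congrFun hω w
  simp only [revealState] at hw
  rw [← hw] at hu ⊢
  ext v
  simp only [mem_cluster] at hu ⊢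
  exact ⟨fun h => conn_trans hu h, fun h => conn_trans (conn_symm hu) h⟩

/-- **`RBcrossOn` from row 2′RB at every weight vector of the graph**: for every `W`, the
per-atom (RB-cross) steps of the revealment by `C(w′)` follow from
`∀ q, IsProbVec q → RBcross q ends o b s t w′` (mine-a §8: holes by the transport, the rest 0-steps). -/
theorem RBcrossOn_of_RBcross_all (hp : IsProbVec p)
    (hRB : ∀ q : E → R, IsProbVec q → RBcross q ends o b s t w') :
    RBcrossOn p ends s t (revealState ends W) (fun ω => cluster ends ω w') (connEvent ends b s)
      (connEvent ends o t) := by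
  intro x
  change atomIneq p ends s t (revealState ends W) (fun ω => cluster ends ω w') (connEvent ends b s)
    (connEvent ends o t) x
  by_cases hsH : ∃ w : ↥W, s ∈ x w
  · obtain ⟨w, hw⟩ := hsH
    -- `X = {b ∈ A_w}` is constant on the atom
    by_cases hb : b ∈ x w
    · refine atomIneq_of_subset_X p ends s t hp _ _ _ _ x ?_
      rintro ω ⟨_, hω⟩
      show Conn ends ω b s
      have h := cluster_eq_of_mem_atom ends W hω hw
      rw [← h] at hb
      exact conn_symm hb
    · refine atomIneq_of_disjoint_X p ends s t _ _ _ _ x ?_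
      rw [Set.eq_empty_iff_forall_notMem]
      rintro ω ⟨⟨_, hω⟩, hX⟩
      have h := cluster_eq_of_mem_atom ends W hω hw
      apply hb
      rw [← h]
      exact conn_symm hX
  · by_cases htH : ∃ w : ↥W, t ∈ x w
    · obtain ⟨w, hw⟩ := htH
      by_cases ho : o ∈ x w
      · refine atomIneq_of_subset_Y p ends s t hp _ _ _ _ x ?_
        rintro ω ⟨_, hω⟩
        show Conn ends ω o t
        have h := cluster_eq_of_mem_atom ends W hω hw
        rw [← h] at ho
        exact conn_symm ho
      · refine atomIneq_of_disjoint_Y p ends s t _ _ _ _ x ?_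
        rw [Set.eq_empty_iff_forall_notMem]
        rintro ω ⟨⟨_, hω⟩, hY⟩
        have h := cluster_eq_of_mem_atom ends W hω hw
        apply ho
        rw [← h]
        exact conn_symm hY
    · by_cases hbH : ∃ w : ↥W, b ∈ x w
      · -- `b` is in a hole while `s` is not: `X` is impossible on the atom
        obtain ⟨w, hw⟩ := hbH
        refine atomIneq_of_disjoint_X p ends s t _ _ _ _ x ?_
        rw [Set.eq_empty_iff_forall_notMem]
        rintro ω ⟨⟨_, hω⟩, hX⟩
        have h := cluster_eq_of_mem_atom ends W hω hw
        apply hsH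
        refine ⟨w, ?_⟩
        rw [← h]
        exact hX
      · by_cases hoH : ∃ w : ↥W, o ∈ x w
        · obtain ⟨w, hw⟩ := hoH
          refine atomIneq_of_disjoint_Y p ends s t _ _ _ _ x ?_
          rw [Set.eq_empty_iff_forall_notMem]
          rintro ω ⟨⟨_, hω⟩, hY⟩
          have h := cluster_eq_of_mem_atom ends W hω hw
          apply htH
          refine ⟨w, ?_⟩
          rw [← h]
          exact hY
        · by_cases hwH : ∃ w : ↥W, w' ∈ x w
          · obtain ⟨w, hw⟩ := hwH
            refine atomIneq_of_const_τ p ends s t _ _ _ _ x (x w) ?_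
            rintro ω ⟨_, hω⟩
            exact cluster_eq_of_mem_atom ends W hω hw
          · -- a hole atom: the transport
            have hs' : s ∉ revHull W x := fun h => hsH (Set.mem_iUnion.1 h)
            have hb' : b ∉ revHull W x := fun h => hbH (Set.mem_iUnion.1 h)
            have ho' : o ∉ revHull W x := fun h => hoH (Set.mem_iUnion.1 h)
            have hw' : w' ∉ revHull W x := fun h => hwH (Set.mem_iUnion.1 h)
            exact atom_step_of_RBcross p ends W o b s t w' x hp hs' hb' ho' hw'
              (hRB _ (isProbVec_pinSet p ends _ hp))

/-- **The chain from row 2′RB**: with `RB_all` (over all graphs), `Cov_{𝓖_{W ∪ {w′}}} ≤ Cov_{𝓖_W}`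
(cleared by `P(Q)`) for every `W` and `w′ ∉ W` — mine-a's `cov_revealed_antitone` unconditionally. -/
theorem covRevealed_insert_le_of_RB_all {V E : Type} [Fintype V] [DecidableEq V] [Fintype E]
    [DecidableEq E] (hall : RB_all R) (ends : E → Sym2 V) {p : E → R} (hp : IsProbVec p)
    (o b s t : V) (hst : s ≠ t) (W : Finset V) {w' : V} (hw : w' ∉ W) :
    covRevealed p ends s t (insert w' W) (connEvent ends b s) (connEvent ends o t) ≤
      covRevealed p ends s t W (connEvent ends b s) (connEvent ends o t) :=
  covRevealed_insert_le p ends s t W hw _ _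
    (RBcrossOn_of_RBcross_all p ends W o b s t w' hp
      (fun q hq => (hall V E ends q hq o b s t w' hst).1))

end Assembly

end RB

end Summit.Ventures.PercRepro2
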